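import Summits.KontsevichZagierPeriods.KontsevichZagierPeriods.Theses.LowDimension
import Summits.KontsevichZagierPeriods.KontsevichZagierPeriods.Theorems.InverseLandauTateLiftingLowdimDuplicationOneThird

/-!
# `LowdimDuplicationOneThird` (stmt-KontsevichZagierPeriods-0118, route LowDimension) — proof

Any two Kontsevich–Zagier integral representations `[(0,1), (x(1−x))^{−2/3}]` and
`[(0,1), 2^{1/3} x^{−1/2} (1−x)^{−2/3}]` on `ℝ¹` (pinned by domain and integrand) are KZ-equivalent
(value identity `B(1/3,1/3) = 2^{1/3} B(1/2,1/3)`): the instance `a = 1/3` of Legendre's duplication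
formula inside the rules. This is verbatim `InverseLandau.tateLifting_lowdimDuplicationOneThird`
(line `Sketch` of the crux `TateLifting`, stmt-KontsevichZagierPeriods-9129, lead c10), which this file
re-exports under the route's name.
-/

namespace Summit.KontsevichZagierPeriods.LowDimension

/-- **`LowdimDuplicationOneThird`** (route LowDimension, stmt-KontsevichZagierPeriods-0118):
`[(0,1), (x(1−x))^{−2/3}] ∼ [(0,1), 2^{1/3} x^{−1/2}(1−x)^{−2/3}]` inside the KZ rules (split at `1/2`,
fold by `x ↦ 1 − x`, substitute `u = (1 − 2x)²`, merge). Proof: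
`InverseLandau.tateLifting_lowdimDuplicationOneThird`. [cite: KontsevichZagier2001, §1.2] -/
theorem lowdimDuplicationOneThird_proof :
    Summit.KontsevichZagierPeriods.KontsevichZagierPeriods.Theses.LowDimension.LowdimDuplicationOneThird :=
  Summit.KontsevichZagierPeriods.InverseLandau.tateLifting_lowdimDuplicationOneThird

end Summit.KontsevichZagierPeriods.LowDimension
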